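import Summits.CriticalPhenomena.PercolationContinuityZ3.Theorems.PercNearOneGluingNoHeavyLowerTailSunflowerRestrictionSingleton
import HarnessLib
import HarnessLib.Audit

/-!
# `NoHeavyLowerTail` (crux stmt-CriticalPhenomena-4575), abstract sunflower cubic: RESTRICTION MONOTONICITY (MZ) at a coordinate
# that acts only through a non-bottom PAIR `{e,f}` (series pair) — second family of proved cases of `RestrictionMonotonicity`

Support file (seat `prim-l12-p2` gen 7; `--supports stmt-CriticalPhenomena-4575`; companion of `…SunflowerRestrictionSingleton` (p222183)).
Memo: run/shared/lean/prim/prim-l12/prim-l12-p2/FINDING-g7-MZ-STRUCTURE.md (identity (ID1)).  Nothing is asserted about the crux; no `sorry`.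

SETTING.  `F : Sunflower α`, a sub-cube `2^W` with `W = insert f W'`, `f ∉ W'`, a new coordinate `e ∉ W`.  HYPOTHESES: the pair is not
bottom, `lab {e,f} ≠ 0`, and WITHOUT `f` the coordinate `e` creates nothing: for `X ⊆ W'`, `lab (insert e X) = lab X` or it promotes a petal
`X` to the top (`hA`).  (Percolation reading, `{j~k}_i` sunflower: `e, f` the two edges of a terminal–terminal path through a degree-2 vertex.)

MAIN RESULTS (this work).
* `nested_insert_split` — one-coordinate split of a nested partition sum for an arbitrary block function.
* `Sunflower.ZP_le_ZP_insert_of_pair` — under the hypotheses above and `0 ≤ ZP W'`, `0 ≤ ZP W` (the partition lemma on the two smaller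
  sub-cubes, available in any induction), `F.ZP W ∅ ∅ ∅ ≤ F.ZP (insert e W) ∅ ∅ ∅`.
  Proof = memo (ID1): `ZP (insert e W) = 3·Σ_X Σ_S s6H (lab (insert e X)) …` (`nested_insert_eq`); split at `f` (`nested_insert_split`);
  the `f ∈ X` part is a principal lift by `v = lab {e,f}` up to petal→top promotions (`joinM_cases`, `joinM_mono_cases`,
  `Sunflower.promotion_sum_nonneg`) hence `≥ ZP W' / 3` (`three_joinLift_ge`); the two `f ∉ X` parts equal the corresponding parts of `ZP W`
  up to POLARISED promotions (`antipodal_gladkov_polarized` with offsets `{f} ⊇ ∅`), and those parts sum to `2/3 · ZP W` (`nested_insert_eq` at `f`).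
-/

namespace Summit.CriticalPhenomena.PercolationContinuityZ3.Theorems.SunflowerPartition

open Finset

/-- Monotonicity cases of `joinM v`: if `x ≤ y` in `M₃` then `joinM v y` is `joinM v x` or a petal→top promotion of it. [this work] -/
theorem joinM_mono_cases : ∀ v x y : Fin 5, v ≠ 0 → (x = y ∨ x = 0 ∨ y = 4) →
    joinM v y = joinM v x ∨ (joinM v y = 4 ∧ (joinM v x = 1 ∨ joinM v x = 2 ∨ joinM v x = 3)) := by decide

variable {α : Type*} [DecidableEq α]

/-- **One-coordinate split** of a nested sum: for `e ∉ W` and any block function `G`, the nested sum on `insert e W` is the sum of the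
three nested sums on `W` with `e` adjoined to the first, second, third block respectively. [this work] -/
theorem nested_insert_split (W : Finset α) (e : α) (he : e ∉ W) (G : Finset α → Finset α → Finset α → ℤ) :
    nested (insert e W) G
      = nested W (fun X S T => G (insert e X) S T) + nested W (fun X S T => G X (insert e S) T)
        + nested W (fun X S T => G X S (insert e T)) := by
  unfold nested
  rw [sum_powerset_insert he]
  have hA : ∀ X ∈ W.powerset,
      (∑ S ∈ (insert e W \ X).powerset, G X S ((insert e W \ X) \ S))
        = (∑ S ∈ (W \ X).powerset, G X S (insert e ((W \ X) \ S)))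
          + ∑ S ∈ (W \ X).powerset, G X (insert e S) ((W \ X) \ S) := by
    intro X hX
    have heX : e ∉ X := fun h => he (mem_powerset.1 hX h)
    have heWX : e ∉ W \ X := fun h => he (mem_sdiff.1 h).1
    rw [insert_sdiff_of_notMem W heX, sum_powerset_insert heWX]
    congr 1
    · refine sum_congr rfl fun S hS => ?_
      have heS : e ∉ S := fun h => heWX (mem_powerset.1 hS h)
      rw [insert_sdiff_of_notMem (W \ X) heS]
    · refine sum_congr rfl fun S hS => ?_
      rw [Sunflower.insert_sdiff_insert_of_not_mem heWX]
  have hB : ∀ X ∈ W.powerset,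
      (∑ S ∈ (insert e W \ insert e X).powerset, G (insert e X) S ((insert e W \ insert e X) \ S))
        = ∑ S ∈ (W \ X).powerset, G (insert e X) S ((W \ X) \ S) := by
    intro X _
    rw [Sunflower.insert_sdiff_insert_of_not_mem he]
  rw [sum_congr rfl hA, sum_congr rfl hB, sum_add_distrib]
  ring

/-- **Polarised promotion**: for a petal `i`, on any cube `V ∌ f`, `0 ≤ Σ_{S ⊆ V} (s6H 4 (lab (insert f S)) (lab (V∖S)) − s6H i …)`
(antipodal Gladkov with offsets `{f} ⊇ ∅`, p214186). [this work] -/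
theorem Sunflower.promotion_sum_polarized_nonneg (F : Sunflower α) (i : Fin 5) (hi : i = 1 ∨ i = 2 ∨ i = 3) (V : Finset α) (f : α) :
    0 ≤ ∑ S ∈ V.powerset, (s6H 4 (F.lab (insert f S)) (F.lab (V \ S)) - s6H i (F.lab (insert f S)) (F.lab (V \ S))) := by
  have h := F.antipodal_gladkov_polarized V {f} ∅ (empty_subset _)
  refine le_trans h (sum_le_sum fun S _ => ?_)
  rw [empty_union, ← insert_eq]
  exact promote_kernel_ge_kk i _ _ hi

/-- **(MZ) at a coordinate acting through a non-bottom pair** (this work, memo (ID1)): let `W = insert f W'` (`f ∉ W'`), `e ∉ W`, `e ≠ f`,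
suppose the pair `{e,f}` is a petal or kernel set, that adjoining `e` to a set `X ⊆ W'` not containing `f` changes nothing except
possibly promoting a petal to the top, and that the partition lemma holds on the sub-cubes `W'` and `W`.  Then `ZP W ≤ ZP (insert e W)`. -/
theorem Sunflower.ZP_le_ZP_insert_of_pair (F : Sunflower α) (W' : Finset α) (e f : α) (hef : e ≠ f) (hf : f ∉ W')
    (he : e ∉ W') (hv : F.lab {e, f} ≠ 0)
    (hA : ∀ X, X ⊆ W' → F.lab (insert e X) = F.lab X ∨ (F.lab (insert e X) = 4 ∧ (F.lab X = 1 ∨ F.lab X = 2 ∨ F.lab X = 3)))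
    (h0 : 0 ≤ F.ZP W' ∅ ∅ ∅) (h1 : 0 ≤ F.ZP (insert f W') ∅ ∅ ∅) :
    F.ZP (insert f W') ∅ ∅ ∅ ≤ F.ZP (insert e (insert f W')) ∅ ∅ ∅ := by
  have heW : e ∉ insert f W' := by
    rw [mem_insert]; rintro (h | h); exact hef h; exact he h
  rw [F.ZP_empty_eq_nested, F.ZP_empty_eq_nested] at *
  rw [F.nested_insert_eq (insert f W') e heW]
  -- split the lifted sum at `f`
  rw [nested_insert_split W' f hf (fun X S T => s6H (F.lab (insert e X)) (F.lab S) (F.lab T))]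
  -- also split `ZP W` at `f` and use `ZP W = 3 B`
  have hZsplit := nested_insert_split W' f hf (fun X S T => s6H (F.lab X) (F.lab S) (F.lab T))
  have hZ3 := F.nested_insert_eq W' f hf
  -- (1) the `f ∈ X` part is a principal lift by `v = lab {e,f}` up to promotions
  have h1a : nested W' (fun X S T => s6H (joinM (F.lab {e, f}) (F.lab (insert f X))) (F.lab S) (F.lab T))
      ≤ nested W' (fun X S T => s6H (F.lab (insert e (insert f X))) (F.lab S) (F.lab T)) := by
    unfold nested
    refine sum_le_sum fun X _ => ?_
    dsimp only
    have hsub1 : ({e, f} : Finset α) ⊆ insert e (insert f X) := by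
      intro x hx; rw [mem_insert, mem_singleton] at hx
      rcases hx with rfl | rfl
      · exact mem_insert_self _ _
      · exact mem_insert_of_mem (mem_insert_self _ _)
    have c1 := F.lab_mono hsub1
    have c2 := F.lab_mono (subset_insert e (insert f X))
    rcases joinM_cases _ _ _ hv c1 c2 with h | ⟨h4, hp⟩
    · rw [h]
    · rw [h4, ← sub_nonneg, ← sum_sub_distrib]
      exact F.promotion_sum_nonneg _ hp (W' \ X)
  have h1b : nested W' (fun X S T => s6H (joinM (F.lab {e, f}) (F.lab X)) (F.lab S) (F.lab T))
      ≤ nested W' (fun X S T => s6H (joinM (F.lab {e, f}) (F.lab (insert f X))) (F.lab S) (F.lab T)) := by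
    unfold nested
    refine sum_le_sum fun X _ => ?_
    dsimp only
    rcases joinM_mono_cases _ _ _ hv (F.lab_mono (subset_insert f X)) with h | ⟨h4, hp⟩
    · rw [h]
    · rw [h4, ← sub_nonneg, ← sum_sub_distrib]
      exact F.promotion_sum_nonneg _ hp (W' \ X)
  have h1c := F.three_joinLift_ge W' (F.lab {e, f}) hv
  -- (2) the two `f ∉ X` parts dominate the corresponding parts of `ZP W` (polarised promotions)
  have h2 : nested W' (fun X S T => s6H (F.lab X) (F.lab (insert f S)) (F.lab T))
      ≤ nested W' (fun X S T => s6H (F.lab (insert e X)) (F.lab (insert f S)) (F.lab T)) := by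
    unfold nested
    refine sum_le_sum fun X hX => ?_
    dsimp only
    rcases hA X (mem_powerset.1 hX) with h | ⟨h4, hp⟩
    · rw [h]
    · rw [h4, ← sub_nonneg, ← sum_sub_distrib]
      exact F.promotion_sum_polarized_nonneg _ hp (W' \ X) f
  have h3 : nested W' (fun X S T => s6H (F.lab (insert e X)) (F.lab S) (F.lab (insert f T)))
      = nested W' (fun X S T => s6H (F.lab (insert e X)) (F.lab (insert f S)) (F.lab T)) := by
    rw [nested_swap23 W' (fun X S T => s6H (F.lab (insert e X)) (F.lab S) (F.lab (insert f T)))]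
    unfold nested
    refine sum_congr rfl fun X _ => sum_congr rfl fun S _ => ?_
    exact (s6H_symm _ _ _).2
  have h3' : nested W' (fun X S T => s6H (F.lab X) (F.lab S) (F.lab (insert f T)))
      = nested W' (fun X S T => s6H (F.lab X) (F.lab (insert f S)) (F.lab T)) := by
    rw [nested_swap23 W' (fun X S T => s6H (F.lab X) (F.lab S) (F.lab (insert f T)))]
    unfold nested
    refine sum_congr rfl fun X _ => sum_congr rfl fun S _ => ?_
    exact (s6H_symm _ _ _).2
  -- bookkeeping
  rw [hZsplit] at h1 ⊢
  rw [hZsplit] at hZ3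
  linarith

end Summit.CriticalPhenomena.PercolationContinuityZ3.Theorems.SunflowerPartition
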